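import Mathlib.CategoryTheory.Pi.Basic
import Literature.IUT.LogThetaLattice.GlobalLGPFrobenioidsRealifiedModel
import Literature.IUT.LogThetaLattice.GlobalFrobenioidModelsIdentification
import HarnessLib

/-!
# [IUTchIII] Proposition 3.7 (iii)–(v) at the CATEGORY level over the number-field model, A: the weighted-diagonal
# embedding functor `†𝒞^⊩_LGP ↪ Π_j (†𝓕⊛ℝ_MOD)_j` and the commutative square of categories of (v)
# (abc-iut cell, layer L6, typer-of-record lineage abc-iut-L6-t4; SUBDAG-IUTchIII-Prop-37 "Frobenioid (categorical)
# level"; part B = `GlobalLGPFrobenioidsCategorical.lean`)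

S. Mochizuki, *Inter-universal Teichmüller theory III*, kurims manuscript (May 2020), §3, Proposition 3.7
(iii)–(v), p. 110 l. 50 – p. 111 l. 78 [claim: Mochizuki2012, status: disputed], read on the page (own render
`paper:url-4b091feeb646` p0110–p0111): (iii) "By applying the composites of the isomorphisms of Frobenioids
«`†𝒞^⊩_j ⥲ (†𝓕⊛ℝ_mod)_j`» … with the realifications «`(†𝓕⊛ℝ_mod)_α ⥲ (†𝓕⊛ℝ_MOD)_α`» … to the global realified
Frobenioid portion `†𝒞^⊩_gau` …, one obtains a functorial algorithm … for constructing a Frobenioid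
`𝒞^⊩_LGP(†𝓗𝓣^{Θ±ell}NF)`"; (v) "The constructions … give rise to a commutative diagram of categories
[`𝒞^⊩_LGP ↪ Π_{j∈𝔽_l^⋇} (†𝓕⊛ℝ_MOD)_j` over `𝒞^⊩_lgp ↪ Π_{j∈𝔽_l^⋇} (†𝓕⊛ℝ_𝔪𝔬𝔡)_j`] — where the horizontal arrows are
embeddings that arise tautologically from the constructions of (iii) and (iv) [cf. [IUTchII], Remark 4.8.1,
(i)]; the vertical arrows are isomorphisms; the left-hand vertical arrow arises from the second isomorphism
that appears in the final display of (iv); the right-hand vertical arrow is the product of the realifications of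
copies of the inverse of the second isomorphism that appears in the final display of (ii)"; together with *II*
(kurims Dec-2020 manuscript, own render `paper:url-5036b4059555`) Cor. 4.5 (v) p. 133 l. 44 – p. 134 l. 8 (the
global realified Gaussian Frobenioid is the "subcategory, equipped with a Frobenioid structure,
`𝒟^⊩_gau(†𝔇^⊢_≻) ⊆ Π_{j∈𝔽_l^⋇} 𝒟^⊩(†𝔇^⊢_≻)_j` … whose divisor and rational function monoids are determined … by the
'vector of ratios' `(…, j²·, …)`"; `𝒟^⊩_env` "isomorphic to the Frobenioid '𝒞^⊩_mod'") and Remark 4.5.4 p. 136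
("a sort of 'weighted diagonal' … the divisor monoid (respectively, rational function monoid) of this
Frobenioid consists of elements of the form `(1²·φ, 2²·φ, …, j²·φ, …)` (respectively, `(1²·β, 2²·β, …)`)").

INPUTS (consumed BY NAME): the realification `(†𝓕⊛ℝ_𝔪𝔬𝔡)_α` = abc-iut-w5-d153's `Prop37.FrakRlfCat F` (the model
Frobenioid of `(Φ^rlf, ℝ·Φ^birat)`, [FrdI] Prop. 5.3, over the number-field model; objects abc-iut-L6-d3's
`ModelFrakObj F`) and its realification functor `Prop37.realification F : Ffrak F ⥤ FrakRlfCat F` from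
abc-iut-w4-d005's integral `(†𝓕⊛_𝔪𝔬𝔡)_α = Prop37.Ffrak F`; abc-iut-L6-t6's `FrakCat`/`MODCat`/`toMOD`.

WHAT THIS FILE ADDS (no `Prop`-valued definition; nothing assumed):
* §1 `nsmulFunctor w` and **`embDiag l⋆ : FrakRlfCat F ⥤ (Fin l⋆ → FrakRlfCat F)`** — the WEIGHTED-DIAGONAL
  EMBEDDING FUNCTOR: on objects `α ↦ (j²·α)_j`, on morphisms `(n, u) ↦ (n, j²·u)_j` (Rmk. 4.5.4 on BOTH the
  divisor and the rational function monoids; Mathlib `Functor.pi'` into the product category); PROVED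
  injective on objects and faithful (`l⋆ ≥ 1`: read off the weight-`1` label, cf. abc-iut-w4-d013's divisor-level
  `phiLGP_ext_of_apply_zero`), with image the weighted diagonal, FULL onto weighted-diagonal morphisms
  (`exists_preimage_of_diagonal` — the subcategory of Cor. 4.5 (v) is exactly the image), and the weights on
  arithmetic degrees `frakDeg ((embDiag l⋆).obj X j).obj = j² · frakDeg X.obj`. Thus the global realified
  LGP- and lgp-Frobenioids `†𝒞^⊩_LGP`, `†𝒞^⊩_lgp` — "isomorphic to `𝒞^⊩_mod`" — are MODELLED by one copy of the
  realification `FrakRlfCat F`, and the horizontal arrows of (v) ARE `embDiag` (embedding = faithful functor,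
  injective on objects).
* §2 the commutative square OF CATEGORIES of (v) as an equality of functors (`square_commutes`); its vertical
  arrows are identity equivalences: left = the TAUTOLOGICAL `†𝔉^⊩_LGP ⥲ †𝔉^⊩_lgp` of (iv) (`Ψ_{𝓕_lgp} :=
  Ψ_{𝓕_LGP}`), right = the realification of `(†𝓕⊛_𝔪𝔬𝔡)_j ⥲ (†𝓕⊛_MOD)_j`, which "induce[s] the tautological
  isomorphisms … on the associated rational function monoids" (p. 110) and the identity on divisor monoids,
  hence ([FrdI] Prop. 5.3) the identity of the realification; "the products of realification functors" of
  p. 112 l. 1–3 = `realificationProd := Functor.pi (fun _ => Prop37.realification F)`; and the record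
  `isoFrakMODCat : Ffrak F ≌ MODCat …` of the tree's torsor version `(†𝓕⊛_MOD)_α` (abc-iut-L6-t6 `toMOD`), which
  part B identifies with `(†𝓕⊛_𝔪𝔬𝔡)_α` as print does ("We shall often use this isomorphism of Frobenioids to
  identify", p. 110 l. 22).

NOT HERE: the object-forming algorithm of (v) and the categorical inhabitant `frobenioidSignature` of
abc-iut-L6-t4's `GlobalLGPFrobenioidSignature` (part B); the identification with layer L1's abstract
`PreFrobenioid.realification`; the `†ρ_{lgp,v}`-compatibility (abc-iut-L5-t2 `InitialThetaData.rho`). Nothing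
here asserts a disputed claim or takes a side on [IUTchIII] Cor. 3.12; typed ≠ discharged; instantiated ≠
endorsed.
-/

noncomputable section

namespace Literature.IUT.LogThetaLattice

namespace Prop37

open CategoryTheory NumberField IsDedekindDomain GlobalFrobenioidModels Literature.IUT.LogVolume
open Literature.AlgebraicGeometry.Frobenioids (Places)

variable (F : Type) [Field F] [NumberField F]

/-! ### §1 The weighted-diagonal embedding functor ([IUTchII] Cor. 4.5 (v), Rmk. 4.5.4; [IUTchIII] Prop. 3.7 (iii)(v)) -/

/-- Scalar bookkeeping in an additive commutative group: `w•(u + n•X − Y) = w•u + n•(w•X) − w•Y`. [folklore] -/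
private theorem weight_identity {A : Type*} [AddCommGroup A] (w n : ℕ) (u X Y : A) :
    w • (u + n • X - Y) = w • u + n • (w • X) - w • Y := by
  rw [nsmul_sub, nsmul_add, ← mul_nsmul X w n, mul_nsmul' X w n]

/-- **Multiplication by a weight `w` on `(†𝓕⊛ℝ_𝔪𝔬𝔡)_α`** as an endofunctor of the model Frobenioid of
`(Φ^rlf, ℝ·Φ^birat)`: objects `α ↦ w·α`, morphisms `(n, u) ↦ (n, w·u)` (the `j`-th component, `w = j²`, of the
"vector of ratios" of [IUTchII] Cor. 4.5 (v) / Rmk. 4.5.4 acting on the divisor AND rational function monoids).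
[claim: Mochizuki2012, status: disputed] -/
def nsmulFunctor (w : ℕ) : FrakRlfCat F ⥤ FrakRlfCat F where
  obj X := FrakRlfCat.of (w • X.obj)
  map {X Y} φ := FrakRlfCat.homMk (FrakRlfCat.deg φ) (w • FrakRlfCat.fn φ)
    ((realRatFn F).nsmul_mem (FrakRlfCat.fn_mem φ) w) (by
      have h := (effDiv (ModelPlaces F) (fun _ => ℝ) nonnegModel).nsmul_mem (FrakRlfCat.eff_mem φ) w
      rw [weight_identity] at h
      exact h)
  map_id X := FrakRlfCat.hom_ext rfl (by
    show w • FrakRlfCat.fn (𝟙 X) = 0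
    rw [FrakRlfCat.fn_id, nsmul_zero])
  map_comp {X Y Z} φ ψ := FrakRlfCat.hom_ext rfl (by
    show w • FrakRlfCat.fn (φ ≫ ψ) = w • FrakRlfCat.fn ψ + (FrakRlfCat.deg ψ : ℕ) • (w • FrakRlfCat.fn φ)
    rw [FrakRlfCat.fn_comp, nsmul_add, ← mul_nsmul (FrakRlfCat.fn φ) w, mul_nsmul'])

/-- `nsmulFunctor w` on objects: `α ↦ w·α`. [claim: Mochizuki2012, status: disputed] -/
@[simp] theorem nsmulFunctor_obj_obj (w : ℕ) (X : FrakRlfCat F) : ((nsmulFunctor F w).obj X).obj = w • X.obj :=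
  rfl

/-- `nsmulFunctor w` preserves Frobenius degrees. [claim: Mochizuki2012, status: disputed] -/
@[simp] theorem deg_nsmulFunctor_map (w : ℕ) {X Y : FrakRlfCat F} (φ : X ⟶ Y) :
    FrakRlfCat.deg ((nsmulFunctor F w).map φ) = FrakRlfCat.deg φ := rfl

/-- `nsmulFunctor w` on rational functions: `u ↦ w·u`. [claim: Mochizuki2012, status: disputed] -/
@[simp] theorem fn_nsmulFunctor_map (w : ℕ) {X Y : FrakRlfCat F} (φ : X ⟶ Y) :
    FrakRlfCat.fn ((nsmulFunctor F w).map φ) = w • FrakRlfCat.fn φ := rfl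

/-- The square weights `j² = (i+1)²` of the labels `j ∈ 𝔽_l^⋇` (index `i : Fin l⋆` stands for `j = i+1`).
[claim: Mochizuki2012, status: disputed] -/
def sqWt {lstar : ℕ} (i : Fin lstar) : ℕ := ((i : ℕ) + 1) ^ 2

/-- **The weighted-diagonal embedding `†𝒞^⊩_LGP ↪ Π_{j∈𝔽_l^⋇} (†𝓕⊛ℝ_MOD)_j`** of [IUTchIII] Prop. 3.7 (iii)/(v) (and
likewise `†𝒞^⊩_lgp ↪ Π_j (†𝓕⊛ℝ_𝔪𝔬𝔡)_j`) as a FUNCTOR into the product category: `α ↦ (1²·α, 2²·α, …, (l⋆)²·α)`,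
`(n, u) ↦ (n, j²·u)_j` — the "weighted diagonal" subcategory of [IUTchII] Cor. 4.5 (v) / Rmk. 4.5.4 inherited by
`†𝒞^⊩_LGP` through the composite isomorphisms of (iii); `†𝒞^⊩_LGP` itself is modelled by ONE copy of the
realification `FrakRlfCat F` ("isomorphic to the Frobenioid `𝒞^⊩_mod`", Cor. 4.5 (v)).
[claim: Mochizuki2012, status: disputed] -/
def embDiag (lstar : ℕ) : FrakRlfCat F ⥤ (Fin lstar → FrakRlfCat F) :=
  Functor.pi' fun i => nsmulFunctor F (sqWt i)

variable {F}

/-- `embDiag` on objects: the `j`-th component is `j²·α`. [claim: Mochizuki2012, status: disputed] -/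
@[simp] theorem embDiag_obj_obj {lstar : ℕ} (X : FrakRlfCat F) (i : Fin lstar) :
    ((embDiag F lstar).obj X i).obj = sqWt i • X.obj := rfl

/-- `embDiag` preserves the (common) Frobenius degree in every component. [claim: Mochizuki2012, status: disputed] -/
@[simp] theorem deg_embDiag_map {lstar : ℕ} {X Y : FrakRlfCat F} (φ : X ⟶ Y) (i : Fin lstar) :
    FrakRlfCat.deg ((embDiag F lstar).map φ i) = FrakRlfCat.deg φ := rfl

/-- `embDiag` on rational functions: the `j`-th component is `j²·u` (Rmk. 4.5.4 "(respectively,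
`(1²·β, 2²·β, …, j²·β, …)`)"). [claim: Mochizuki2012, status: disputed] -/
@[simp] theorem fn_embDiag_map {lstar : ℕ} {X Y : FrakRlfCat F} (φ : X ⟶ Y) (i : Fin lstar) :
    FrakRlfCat.fn ((embDiag F lstar).map φ i) = sqWt i • FrakRlfCat.fn φ := rfl

/-- The first label `j = 1` (weight `1² = 1`), available as soon as `l⋆ ≥ 1`. [claim: Mochizuki2012, status: disputed] -/
def firstLabel {lstar : ℕ} (hl : 0 < lstar) : Fin lstar := ⟨0, hl⟩

/-- The first label has weight `1² = 1` ([IUTchII] Rmk. 4.5.4 "(1²·φ, 2²·φ, …)"). [claim: Mochizuki2012, status: disputed] -/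
@[simp] theorem sqWt_firstLabel {lstar : ℕ} (hl : 0 < lstar) : sqWt (firstLabel hl) = 1 := by
  simp [sqWt, firstLabel]

/-- **The horizontal arrows of Prop. 3.7 (v) are embeddings, I**: `embDiag` is injective on objects (`l⋆ ≥ 1`;
read off the weight-`1` component, cf. abc-iut-w4-d013's `phiLGP_ext_of_apply_zero` at divisor level).
[claim: Mochizuki2012, status: disputed] -/
theorem embDiag_obj_injective {lstar : ℕ} (hl : 0 < lstar) : Function.Injective (embDiag F lstar).obj := by
  intro X Y h
  have h1 := congrArg (fun Z : Fin lstar → FrakRlfCat F => (Z (firstLabel hl)).obj) h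
  simp only [embDiag_obj_obj, sqWt_firstLabel, one_nsmul] at h1
  rw [← FrakRlfCat.of_obj X, ← FrakRlfCat.of_obj Y, h1]

/-- **The horizontal arrows of Prop. 3.7 (v) are embeddings, II**: `embDiag` is faithful (`l⋆ ≥ 1`).
[claim: Mochizuki2012, status: disputed] -/
theorem embDiag_faithful {lstar : ℕ} (hl : 0 < lstar) : (embDiag F lstar).Faithful where
  map_injective {X Y} := fun φ ψ h => by
    have h1 := congrArg (fun η : (embDiag F lstar).obj X ⟶ (embDiag F lstar).obj Y => η (firstLabel hl)) h
    have hdeg := congrArg FrakRlfCat.deg h1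
    have hfn := congrArg FrakRlfCat.fn h1
    simp only [deg_embDiag_map] at hdeg
    simp only [fn_embDiag_map, sqWt_firstLabel, one_nsmul] at hfn
    exact FrakRlfCat.hom_ext hdeg hfn

/-- **The image of `embDiag` is the weighted diagonal** on objects ("the divisor monoid … consists of elements of
the form `(1²·φ, 2²·φ, …)`", Rmk. 4.5.4). [claim: Mochizuki2012, status: disputed] -/
theorem embDiag_obj_diagonal {lstar : ℕ} (X : FrakRlfCat F) :
    ∃ α : ModelFrakObj F, ∀ i : Fin lstar, ((embDiag F lstar).obj X i).obj = sqWt i • α :=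
  ⟨X.obj, fun _ => rfl⟩

/-- … and on morphisms: common Frobenius degree and rational functions `(1²·β, 2²·β, …)` (Rmk. 4.5.4).
[claim: Mochizuki2012, status: disputed] -/
theorem embDiag_map_diagonal {lstar : ℕ} {X Y : FrakRlfCat F} (φ : X ⟶ Y) :
    (∃ n : ℕ+, ∀ i : Fin lstar, FrakRlfCat.deg ((embDiag F lstar).map φ i) = n) ∧
      ∃ u : ModelFrakObj F, ∀ i : Fin lstar, FrakRlfCat.fn ((embDiag F lstar).map φ i) = sqWt i • u :=
  ⟨⟨FrakRlfCat.deg φ, fun _ => rfl⟩, FrakRlfCat.fn φ, fun _ => rfl⟩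

/-- **`embDiag` is FULL onto the weighted diagonal**: a morphism of the product category between embedded
objects with a common Frobenius degree and weighted-diagonal rational functions comes from `†𝒞^⊩_LGP` (`l⋆ ≥ 1`)
— the subcategory of Cor. 4.5 (v) is exactly the image. [claim: Mochizuki2012, status: disputed] -/
theorem exists_preimage_of_diagonal {lstar : ℕ} (hl : 0 < lstar) {X Y : FrakRlfCat F}
    (ψ : (embDiag F lstar).obj X ⟶ (embDiag F lstar).obj Y) (n : ℕ+) (u : ModelFrakObj F)
    (hdeg : ∀ i, FrakRlfCat.deg (ψ i) = n) (hfn : ∀ i, FrakRlfCat.fn (ψ i) = sqWt i • u) :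
    ∃ φ : X ⟶ Y, (embDiag F lstar).map φ = ψ := by
  have hu : u ∈ realRatFn F := by
    have h := FrakRlfCat.fn_mem (ψ (firstLabel hl))
    rwa [hfn, sqWt_firstLabel, one_nsmul] at h
  have heff : u + (n : ℕ) • X.obj - Y.obj ∈ effDiv (ModelPlaces F) (fun _ => ℝ) nonnegModel := by
    have h := FrakRlfCat.eff_mem (ψ (firstLabel hl))
    simp only [hfn, hdeg, embDiag_obj_obj, sqWt_firstLabel, one_nsmul] at h
    exact h
  refine ⟨FrakRlfCat.homMk n u hu heff, ?_⟩
  funext i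
  exact FrakRlfCat.hom_ext (by rw [deg_embDiag_map, FrakRlfCat.deg_homMk, hdeg])
    (by rw [fn_embDiag_map, FrakRlfCat.fn_homMk, hfn])

/-- `frakDeg` of a natural multiple (plumbing). [folklore] -/
private theorem frakDeg_nsmul (w : ℕ) (J : ModelFrakObj F) : frakDeg (w • J) = w * frakDeg J := by
  induction w with
  | zero => rw [zero_nsmul, frakDeg_zero, Nat.cast_zero, zero_mul]
  | succ w ih => rw [succ_nsmul, frakDeg_add, ih]; push_cast; ring

/-- **The LGP weights on arithmetic degrees**: the `j`-th component of the embedded object has degree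
`j² · deg(α)` (so the average over `j ∈ 𝔽_l^⋇` carries the factor `(l⋆+1)(2l⋆+1)/6` of abc-iut-c312-3's
`degLgp_thetaPilot`). [claim: Mochizuki2012, status: disputed] -/
theorem frakDeg_embDiag_obj {lstar : ℕ} (X : FrakRlfCat F) (i : Fin lstar) :
    frakDeg ((embDiag F lstar).obj X i).obj = (sqWt i : ℝ) * frakDeg X.obj := by
  rw [embDiag_obj_obj, frakDeg_nsmul]

/-! ### §2 The commutative square of categories of Prop. 3.7 (v) -/

variable (F)

/-- The left vertical arrow `†𝒞^⊩_LGP ⥲ †𝒞^⊩_lgp` of the square of Prop. 3.7 (v) p. 111 ("arises from the second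
isomorphism that appears in the final display of (iv)", i.e. the TAUTOLOGICAL isomorphism `†𝔉^⊩_LGP ⥲ †𝔉^⊩_lgp` —
`Ψ_{𝓕_lgp} := Ψ_{𝓕_LGP}`, `†𝔉^⊢_lgp := †𝔉^⊢_LGP`): both global realified Frobenioids are modelled by the one
realification `FrakRlfCat F`, and the arrow is the identity equivalence. [claim: Mochizuki2012, status: disputed] -/
def isoCLGPlgpCat : FrakRlfCat F ≌ FrakRlfCat F := CategoryTheory.Equivalence.refl

/-- The right vertical arrow of the square of Prop. 3.7 (v): "the product of the realifications of copies of the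
inverse of the second isomorphism that appears in the final display of (ii)" — the realification of
`(†𝓕⊛_𝔪𝔬𝔡)_j ⥲ (†𝓕⊛_MOD)_j`, which "induce[s] the tautological isomorphism … on the associated rational function
monoids" (p. 110) and the identity on divisor monoids, hence ([FrdI] Prop. 5.3: the realification is the model
Frobenioid of `(Φ^rlf, ℝ·Φ^birat)`) the identity of `FrakRlfCat F`, one factor per `j ∈ 𝔽_l^⋇`.
[claim: Mochizuki2012, status: disputed] -/
def rlfIsoProd (lstar : ℕ) : (Fin lstar → FrakRlfCat F) ⥤ (Fin lstar → FrakRlfCat F) :=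
  Functor.pi fun _ : Fin lstar => (CategoryTheory.Equivalence.refl (C := FrakRlfCat F)).functor

/-- **The diagram of categories of [IUTchIII] Prop. 3.7 (v) p. 111 COMMUTES** at the model: going right along
`†𝒞^⊩_LGP ↪ Π_j (†𝓕⊛ℝ_MOD)_j` and down the product of realified inverse isomorphisms equals going down
`†𝒞^⊩_LGP ⥲ †𝒞^⊩_lgp` and right along `†𝒞^⊩_lgp ↪ Π_j (†𝓕⊛ℝ_𝔪𝔬𝔡)_j` (an equality of functors).
[claim: Mochizuki2012, status: disputed] -/
theorem square_commutes (lstar : ℕ) :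
    embDiag F lstar ⋙ rlfIsoProd F lstar = (isoCLGPlgpCat F).functor ⋙ embDiag F lstar :=
  rfl

/-- "The products of realification functors `Π_j (†𝓕⊛_𝔪𝔬𝔡)_j → Π_j (†𝓕⊛ℝ_𝔪𝔬𝔡)_j` [cf. [FrdI], Proposition 5.3]"
(Prop. 3.7 (v) p. 112 l. 1–3): the product over `j ∈ 𝔽_l^⋇` of abc-iut-w5-d153's realification functor.
[claim: Mochizuki2012, status: disputed] -/
def realificationProd (lstar : ℕ) : (Fin lstar → Ffrak F) ⥤ (Fin lstar → FrakRlfCat F) :=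
  Functor.pi fun _ : Fin lstar => realification F

/-- `realificationProd` is the realification functor in each factor. [claim: Mochizuki2012, status: disputed] -/
@[simp] theorem realificationProd_obj (lstar : ℕ) (J : Fin lstar → Ffrak F) (i : Fin lstar) :
    (realificationProd F lstar).obj J i = (realification F).obj (J i) := rfl

/-- Record of the tree's DISTINCT models identified here along Prop. 3.7 (i)(ii) (p. 110 l. 22 "We shall often
use this isomorphism of Frobenioids to identify"): the torsor version `(†𝓕⊛_MOD)_α` of Example 3.6 (i) is
abc-iut-L6-t6's `MODCat`, equivalent to `(†𝓕⊛_𝔪𝔬𝔡)_α = Ffrak F` by abc-iut-L6-t6's `toMOD`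
(`GlobalFrobenioidModelsIdentification.lean`); the [FrdI] Thm. 5.2 model `(†𝓕⊛_mod)_α` is `Prop37.FmodModel F` via
abc-iut-w4-d005's `Prop37.isoFrakMod`. [claim: Mochizuki2012, status: disputed] -/
def isoFrakMODCat : Ffrak F ≌ MODCat F (Places F) (Gamma F) (nonneg F) (beta F) :=
  (toMOD (F := F) (V := Places F) (Γ := Gamma F) (nonneg := nonneg F) (β := beta F)).asEquivalence

end Prop37

end Literature.IUT.LogThetaLattice

end
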